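import Mathlib.CategoryTheory.Limits.IsLimit
import Mathlib.CategoryTheory.Filtered.Basic
import Mathlib.Order.ULift
import Literature.AnabelianGeometry.EtaleTheta.TemperedFrobenioidCor38Sub
import Literature.AlgebraicGeometry.Frobenioids.PerfectionCoAngularDivisorsOver
import Literature.AlgebraicGeometry.Frobenioids.PerfectionPreFrobenioid
import Literature.AlgebraicGeometry.Frobenioids.CoAngular
import Literature.AlgebraicGeometry.Frobenioids.BiratGerms
import Literature.AnabelianGeometry.EtaleTheta.Discharge.Sec3Thm37Holds
import HarnessLib

/-!
# [EtTh] Corollary 3.8 (i) sub-DAG — row C38-L05, part (a)/(b): the category `(C^pf)^coa-pre_X` of the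
# perfection of a tempered Frobenioid is THIN and indexed by the elements `(ψ^*)⁻¹ Div ψ ∈ Φ^pf(Base X)`;
# cofiltered limits in it are suprema for divisibility

Mochizuki, *The étale theta function …*, Publ. RIMS **45** (2009), Cor. 3.8, proof PDF p.81 l.20–27: "a pre-step
of `C_i` is base-field-theoretic if and only if its image `A → B` in `C_i^pf` may be written as a [filtered]
projective limit in the category `(C_i^pf)^coa-pre_B` … of pre-steps `A' → B` that are abstractly equivalent to an
endomorphism that belongs to '`O^▷(−)`'", justified in print by "[cf. Proposition 3.4, (ii); the equivalences of
categories of [Mzk17], Definition 1.3, (iii), (d), determined by the operation of taking the zero divisor of a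
co-angular pre-step]" [cite: MochizukiEtTh2009, Cor 3.8 p.81].  abc-iut cell, layer L2, seat abc-iut-w5-d124,
companion of `TemperedFrobenioidCor38Sub.lean` (p414329, plan/L2/SUBDAG-EtTh-Cor38.md, row **C38-L05**, sub-rows
L05a/L05b of §F).  For THE perfection `P := PreFrobenioidData.perfection hF` of a tempered Frobenioid `C`
(`hF : IsFrobenioid C.toElem`, [FrdI] Thm. 5.2 (ii)):

* L05a — `(C^pf)^coa-pre_X` (`CoaPreOver P X`) is a THIN category ([FrdI] Def. 1.3 (v)(a): pre-steps are
  monomorphisms, L1 `Perfection.mono_of_isPreStep`), every element of `Φ^pf(Base X)` is the invariant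
  `δ(Y, ψ) := (ψ^*)⁻¹ Div ψ` of some object, and `Hom((Y, ψ), (Y', ψ')) ≠ ∅ ⟺ δ(Y', ψ') ∣ δ(Y, ψ)` — the [FrdI]
  Def. 1.3 (iii)(d) slice equivalence `(C^coa-pre)_A → Order(Φ(A))^opp` for `C^pf` (L1's functor-level
  `Perfection.iii_d_over_full/surj_perfection`, seat abc-iut-w5-d246);
* L05b — `IsLimitOfOTriLike P ψ` (a cofiltered limit in `(C^pf)^coa-pre_X` of "O^▷-like" pre-steps, row C38-L05's
  rendering of print's "[filtered] projective limit") holds iff `δ(ψ)` is the SUPREMUM, for divisibility in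
  `Φ^pf(Base X)`, of a nonempty directed family of invariants `δ` of O^▷-like pre-steps bounded by `δ(ψ)`
  (`isLimitOfOTriLike_iff_isLUB`).
Proof-only apart from the bookkeeping abbreviation `sliceDiv` (= L1's `invDiv`) and the thin-category limit
constructor `isLimitOfForall`.  Nothing here is specific to the disputed corpus.  HONEST FRAMING: refereed pre-IUT
material; nothing here bears on [IUTchIII] Cor. 3.12.
-/

namespace Literature.AnabelianGeometry.EtaleTheta

open CategoryTheory Opposite Limits Literature.AlgebraicGeometry.Frobenioids

universe u₀ v₀ u v w

variable {D₀ : Type u₀} [Category.{v₀} D₀] {V : FrdIMonoidStub.{w}}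
  {T : RealifiedDivisorMonoids (D₀ := D₀) V} {D : Type u} [Category.{v} D] {VD : FrdICatStub.{u, v, w} D}

namespace TemperedFrobenioid

variable (C : TemperedFrobenioid T D VD)

/-- A tempered Frobenioid is of Frobenius-isotropic type (it is of isotropic type, Thm. 3.7 (i),
`thm37_i_isotropic_holds`; the identity is an arrow of Frobenius type). [cite: MochizukiEtTh2009, Thm 3.7 p.79] -/
theorem isOfType_isFrobeniusIsotropic (hF : PreFrobenioid.IsFrobenioid C.toElem) :
    PreFrobenioid.IsOfType (PreFrobenioid.IsFrobeniusIsotropic C.toElem) := fun A =>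
  ⟨A, 𝟙 A, PreFrobenioid.isFrobeniusType_of_isIso C.toElem hF.isPreFrobenioid (𝟙 A),
    C.thm37_i_isotropic_holds A⟩

end TemperedFrobenioid

namespace Cor38Criterion

open TemperedFrobenioid

variable {C : TemperedFrobenioid T D VD} {hF : PreFrobenioid.IsFrobenioid C.toElem}

/-! ### §1 Bookkeeping on the perfection `C^pf` (always through `P := PreFrobenioidData.perfection hF`) -/

/-- For the operations of `C^pf`, the operations-level notion "co-angular pre-step" (used by `CoaPreOver`) is
found's functor-level notion for the structure functor (used by L1's slice lemmas).
[cite: MochizukiFrdI2008, Def. 1.3 (iii) p.24] -/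
theorem isCoAngularPreStep_ops_iff {X Y : (PreFrobenioidData.perfection hF).Pf} (ψ : Y ⟶ X) :
    (PreFrobenioidData.perfection hF).ops.IsCoAngularPreStep ψ ↔
      PreFrobenioid.IsCoAngularPreStep (PreFrobenioidData.perfection hF).ops.toFunctor ψ :=
  Iff.and (PreFrobenioidData.ofFunctor_isCoAngular (PreFrobenioidData.perfection hF).ops.toFunctor ψ) Iff.rfl

/-- Every pre-step of `C^pf` is a co-angular pre-step (every arrow of `C^pf` is co-angular, `C` being of
Frobenius-isotropic type: L1 `isCoAngular_of_frobeniusIsotropic`). [cite: MochizukiFrdI2008, Prop. 3.2 (iii) p.59] -/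
theorem isCoAngularPreStep_of_isPreStep {X Y : (PreFrobenioidData.perfection hF).Pf} {ψ : Y ⟶ X}
    (h : (PreFrobenioidData.perfection hF).ops.IsPreStep ψ) :
    (PreFrobenioidData.perfection hF).ops.IsCoAngularPreStep ψ :=
  ⟨PreFrobenioid.Perfection.isCoAngular_of_frobeniusIsotropic (hF := hF) (C.isOfType_isFrobeniusIsotropic hF) ψ, h⟩

/-- Pre-steps of `C^pf` are monomorphisms ([FrdI] Def. 1.3 (v)(a) for `C^pf`, L1).
[cite: MochizukiFrdI2008, Def. 1.3 (v) p.25] -/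
theorem mono_of_isPreStep {X Y : (PreFrobenioidData.perfection hF).Pf} {ψ : Y ⟶ X}
    (h : (PreFrobenioidData.perfection hF).ops.IsPreStep ψ) : Mono ψ :=
  PreFrobenioid.Perfection.mono_of_isPreStep (hF := hF) h

/-- `(ψ^*)⁻¹ Div ψ` does not depend on the way the arrow is written (rewriting lemma).
[cite: MochizukiFrdI2008, Def. 1.3 (iii) p.24] -/
theorem invDiv_congr {E : Type*} [Category E] {B : Type*} [Category B] {Ψ : Bᵒᵖ ⥤ CommMonCat}
    (G : E ⥤ ElemFrobenioid Ψ) {Y X : E} {ψ₁ ψ₂ : Y ⟶ X} (e : ψ₁ = ψ₂) (h₁ : PreFrobenioid.IsBaseIso G ψ₁)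
    (h₂ : PreFrobenioid.IsBaseIso G ψ₂) : PreFrobenioid.invDiv G ψ₁ h₁ = PreFrobenioid.invDiv G ψ₂ h₂ := by
  subst e; rfl

variable (hF) in
/-- `δ(Y, ψ) := (ψ^*)⁻¹ Div ψ ∈ Φ^pf(Base X)` for an object `(Y, ψ : Y → X)` of `(C^pf)^coa-pre_X` — "the operation
of taking the zero divisor of a co-angular pre-step" of [FrdI] Def. 1.3 (iii)(d), slice form (bookkeeping name
for L1's `invDiv` of the structure functor of `C^pf`). [cite: MochizukiFrdI2008, Def. 1.3 (iii) p.24] -/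
noncomputable def sliceDiv {X : (PreFrobenioidData.perfection hF).Pf}
    (U : CoaPreOver (PreFrobenioidData.perfection hF) X) :
    (PreFrobenioidData.perfection hF).ops.monFunctor.obj
      (op (PreFrobenioid.baseObj (PreFrobenioidData.perfection hF).ops.toFunctor X)) :=
  PreFrobenioid.invDiv (PreFrobenioidData.perfection hF).ops.toFunctor U.obj.hom U.property.2.2

/-- `δ` of an object only depends on its arrow (rewriting lemma). [cite: MochizukiFrdI2008, Def. 1.3 (iii) p.24] -/
theorem sliceDiv_mk {X Y : (PreFrobenioidData.perfection hF).Pf} (ψ : Y ⟶ X)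
    (hψ : (PreFrobenioidData.perfection hF).ops.IsCoAngularPreStep ψ) :
    sliceDiv hF (⟨Over.mk ψ, hψ⟩ : CoaPreOver (PreFrobenioidData.perfection hF) X) =
      PreFrobenioid.invDiv (PreFrobenioidData.perfection hF).ops.toFunctor ψ hψ.2.2 := rfl

/-! ### §2 L05a: `(C^pf)^coa-pre_X` is thin and indexed by `δ` -/

/-- Pre-steps of `C^pf` are monomorphisms, so `(C^pf)^coa-pre_X` is a thin category.
[cite: MochizukiFrdI2008, Def. 1.3 (v) p.25] -/
theorem subsingleton_hom {X : (PreFrobenioidData.perfection hF).Pf}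
    (U U' : CoaPreOver (PreFrobenioidData.perfection hF) X) : Subsingleton (U ⟶ U') := ⟨fun a b => by
  apply ObjectProperty.hom_ext; apply Over.OverMorphism.ext
  haveI := mono_of_isPreStep U'.property.2
  rw [← cancel_mono U'.obj.hom, Over.w a.hom, Over.w b.hom]⟩

/-- A morphism `(Y, ψ) → (Y', ψ')` of `(C^pf)^coa-pre_X` forces `δ(Y', ψ') ∣ δ(Y, ψ)` (Remark 1.1.1:
`(ψ^*)⁻¹ Div(g ≫ ψ') = (ψ'^*)⁻¹ Div ψ' · (ψ^*)⁻¹ Div g`). [cite: MochizukiFrdI2008, Def. 1.3 (iii) p.24] -/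
theorem sliceDiv_dvd_of_hom {X : (PreFrobenioidData.perfection hF).Pf}
    {U U' : CoaPreOver (PreFrobenioidData.perfection hF) X} (a : U ⟶ U') : sliceDiv hF U' ∣ sliceDiv hF U := by
  have hw : a.hom.left ≫ U'.obj.hom = U.obj.hom := Over.w a.hom
  have hψ' : PreFrobenioid.IsPreStep (PreFrobenioidData.perfection hF).ops.toFunctor U'.obj.hom := U'.property.2
  haveI : IsIso (PreFrobenioid.Base (PreFrobenioidData.perfection hF).ops.toFunctor U'.obj.hom) := hψ'.2
  haveI : IsIso (PreFrobenioid.Base (PreFrobenioidData.perfection hF).ops.toFunctor U.obj.hom) := U.property.2.2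
  have hg : PreFrobenioid.IsBaseIso (PreFrobenioidData.perfection hF).ops.toFunctor a.hom.left := by
    have e : PreFrobenioid.Base (PreFrobenioidData.perfection hF).ops.toFunctor a.hom.left =
        PreFrobenioid.Base (PreFrobenioidData.perfection hF).ops.toFunctor U.obj.hom ≫
          inv (PreFrobenioid.Base (PreFrobenioidData.perfection hF).ops.toFunctor U'.obj.hom) := by
      rw [IsIso.eq_comp_inv, ← PreFrobenioid.base_comp, hw]
    change IsIso _
    rw [e]
    infer_instance
  have hc : PreFrobenioid.IsBaseIso (PreFrobenioidData.perfection hF).ops.toFunctor (a.hom.left ≫ U'.obj.hom) := by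
    rw [hw]; exact U.property.2.2
  have key := PreFrobenioid.pull_invDiv_comp (PreFrobenioidData.perfection hF).ops.toFunctor a.hom.left
    U'.obj.hom hg hψ' hc
  rw [invDiv_congr _ hw hc U.property.2.2] at key
  refine ⟨pull (PreFrobenioidData.perfection hF).ops.monFunctor
      (inv (PreFrobenioid.Base (PreFrobenioidData.perfection hF).ops.toFunctor U'.obj.hom))
      (PreFrobenioid.invDiv (PreFrobenioidData.perfection hF).ops.toFunctor a.hom.left hg), ?_⟩
  unfold sliceDiv
  apply PreFrobenioid.pull_injective (Φ := (PreFrobenioidData.perfection hF).ops.monFunctor)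
    (PreFrobenioid.Base (PreFrobenioidData.perfection hF).ops.toFunctor U'.obj.hom)
  rw [key, map_mul, PreFrobenioid.pull_invDiv, ← pull_comp, IsIso.hom_inv_id, pull_id]

/-- Conversely `δ(Y', ψ') ∣ δ(Y, ψ)` is realised by a morphism `(Y, ψ) → (Y', ψ')` ([FrdI] Def. 1.3 (iii)(d) for
`C^pf`, slice, fullness: L1 `iii_d_over_full_perfection`). [cite: MochizukiFrdI2008, Prop. 3.2 (iii) p.59] -/
theorem nonempty_hom_of_sliceDiv_dvd {X : (PreFrobenioidData.perfection hF).Pf}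
    {U U' : CoaPreOver (PreFrobenioidData.perfection hF) X} (h : sliceDiv hF U' ∣ sliceDiv hF U) :
    Nonempty (U ⟶ U') := by
  obtain ⟨g, -, hg⟩ := PreFrobenioid.Perfection.iii_d_over_full_perfection (hF := hF)
    (C.isOfType_isFrobeniusIsotropic hF) U.obj.hom U'.obj.hom ((isCoAngularPreStep_ops_iff _).1 U.property)
    ((isCoAngularPreStep_ops_iff _).1 U'.property) h
  exact ⟨ObjectProperty.homMk (Over.homMk g hg)⟩

/-- `Hom((Y, ψ), (Y', ψ')) ≠ ∅ ⟺ δ(Y', ψ') ∣ δ(Y, ψ)`: `(C^pf)^coa-pre_X` "is" the divisibility order of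
`Φ^pf(Base X)` reversed ([FrdI] Def. 1.3 (iii)(d)). [cite: MochizukiFrdI2008, Def. 1.3 (iii) p.24] -/
theorem nonempty_hom_iff_sliceDiv_dvd {X : (PreFrobenioidData.perfection hF).Pf}
    (U U' : CoaPreOver (PreFrobenioidData.perfection hF) X) :
    Nonempty (U ⟶ U') ↔ sliceDiv hF U' ∣ sliceDiv hF U :=
  ⟨fun ⟨a⟩ => sliceDiv_dvd_of_hom a, nonempty_hom_of_sliceDiv_dvd⟩

/-- Every element of `Φ^pf(Base X)` is `δ` of some object of `(C^pf)^coa-pre_X` ([FrdI] Def. 1.3 (iii)(d) for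
`C^pf`, slice, essential surjectivity: L1 `iii_d_over_surj_perfection`). [cite: MochizukiFrdI2008, Prop. 3.2 (iii) p.59] -/
theorem exists_sliceDiv_eq (X : (PreFrobenioidData.perfection hF).Pf)
    (y : (PreFrobenioidData.perfection hF).ops.monFunctor.obj
      (op (PreFrobenioid.baseObj (PreFrobenioidData.perfection hF).ops.toFunctor X))) :
    ∃ U : CoaPreOver (PreFrobenioidData.perfection hF) X, sliceDiv hF U = y := by
  obtain ⟨Y, ψ, h, hy⟩ :=
    PreFrobenioid.Perfection.iii_d_over_surj_perfection (hF := hF) (C.isOfType_isFrobeniusIsotropic hF) X y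
  exact ⟨⟨Over.mk ψ, (isCoAngularPreStep_ops_iff ψ).2 h⟩, hy⟩

/-- Isomorphic objects of `(C^pf)^coa-pre_X` have the same `δ` (`δ` is unchanged by pre-composition with an
isomorphism, L1 `invDiv_iso_comp`). [cite: MochizukiFrdI2008, Def. 1.3 (iii) p.24] -/
theorem sliceDiv_eq_of_iso {X : (PreFrobenioidData.perfection hF).Pf}
    {U U' : CoaPreOver (PreFrobenioidData.perfection hF) X} (i : U ≅ U') : sliceDiv hF U = sliceDiv hF U' := by
  have hw : i.hom.hom.left ≫ U'.obj.hom = U.obj.hom := Over.w i.hom.hom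
  haveI : IsIso i.hom.hom.left :=
    ⟨⟨i.inv.hom.left, congrArg (fun t => t.hom.left) i.hom_inv_id, congrArg (fun t => t.hom.left) i.inv_hom_id⟩⟩
  have hc : PreFrobenioid.IsBaseIso (PreFrobenioidData.perfection hF).ops.toFunctor (i.hom.hom.left ≫ U'.obj.hom) := by
    rw [hw]; exact U.property.2.2
  change PreFrobenioid.invDiv (PreFrobenioidData.perfection hF).ops.toFunctor U.obj.hom U.property.2.2 =
    PreFrobenioid.invDiv (PreFrobenioidData.perfection hF).ops.toFunctor U'.obj.hom U'.property.2.2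
  rw [← invDiv_congr _ hw hc U.property.2.2]
  exact PreFrobenioid.Perfection.invDiv_iso_comp (PreFrobenioid.Perfection.isPreFrobenioid_perfection (hF := hF))
    i.hom.hom.left U'.obj.hom U'.property.2.2 hc

/-! ### §3 L05b: cofiltered limits of O^▷-like pre-steps in `(C^pf)^coa-pre_X` are suprema for divisibility -/

/-- In the thin category `(C^pf)^coa-pre_X` a cone is a limit cone as soon as every cone point maps to its point.
[cite: MochizukiFrdI2008, Def. 1.3 (iii) p.24] -/
noncomputable def isLimitOfForall {X : (PreFrobenioidData.perfection hF).Pf} {J : Type*} [Category J]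
    {F : J ⥤ CoaPreOver (PreFrobenioidData.perfection hF) X} (c : Cone F)
    (h : ∀ s : Cone F, Nonempty (s.pt ⟶ c.pt)) : IsLimit c where
  lift s := (h s).some
  fac _ _ := (subsingleton_hom _ _).elim _ _
  uniq _ _ _ := (subsingleton_hom _ _).elim _ _

/-- **L05b** (row C38-L05 of the sub-DAG, §F): for a co-angular pre-step `ψ : Y → X` of `C^pf`, `ψ` "may be written
as a [filtered] projective limit in `(C^pf)^coa-pre_X` of pre-steps that are abstractly equivalent to an
endomorphism that belongs to `O^▷(−)`" (`IsLimitOfOTriLike`) if and only if `δ(ψ)` is the supremum, for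
divisibility in `Φ^pf(Base X)`, of a nonempty directed family of elements `δ` of such O^▷-like pre-steps over `X`
that divide `δ(ψ)`. [cite: MochizukiEtTh2009, Cor 3.8 p.81] -/
theorem isLimitOfOTriLike_iff_isLUB {X Y : (PreFrobenioidData.perfection hF).Pf} (ψ : Y ⟶ X)
    (hψ : (PreFrobenioidData.perfection hF).ops.IsCoAngularPreStep ψ) :
    IsLimitOfOTriLike (PreFrobenioidData.perfection hF) ψ ↔
      ∃ S : Set ((PreFrobenioidData.perfection hF).ops.monFunctor.obj
      (op (PreFrobenioid.baseObj (PreFrobenioidData.perfection hF).ops.toFunctor X))),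
        (∀ s ∈ S, ∃ U : CoaPreOver (PreFrobenioidData.perfection hF) X,
            IsOTriLikePreStep (PreFrobenioidData.perfection hF) U.obj.hom ∧ sliceDiv hF U = s) ∧
        S.Nonempty ∧ DirectedOn (fun a b => a ∣ b) S ∧
        (∀ s ∈ S, s ∣ sliceDiv hF ⟨Over.mk ψ, hψ⟩) ∧
        ∀ z, (∀ s ∈ S, s ∣ z) → sliceDiv hF ⟨Over.mk ψ, hψ⟩ ∣ z := by
  constructor
  · rintro ⟨hψ₀, J, _, _, F, π, hOT, ⟨hl⟩⟩
    refine ⟨Set.range fun j => sliceDiv hF (F.obj j), ?_, ?_, ?_, ?_, ?_⟩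
    · rintro _ ⟨j, rfl⟩
      exact ⟨F.obj j, hOT j, rfl⟩
    · obtain ⟨j⟩ := IsCofiltered.nonempty (C := J)
      exact ⟨_, j, rfl⟩
    · rintro _ ⟨j, rfl⟩ _ ⟨j', rfl⟩
      exact ⟨_, ⟨IsCofiltered.min j j', rfl⟩, sliceDiv_dvd_of_hom (F.map (IsCofiltered.minToLeft j j')),
        sliceDiv_dvd_of_hom (F.map (IsCofiltered.minToRight j j'))⟩
    · rintro _ ⟨j, rfl⟩
      exact sliceDiv_dvd_of_hom (π.app j)
    · intro z hz
      obtain ⟨Uz, hUz⟩ := exists_sliceDiv_eq X z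
      have hc : ∀ j, Nonempty (Uz ⟶ F.obj j) := fun j =>
        nonempty_hom_of_sliceDiv_dvd (hUz ▸ hz _ ⟨j, rfl⟩)
      let s : Cone F :=
        { pt := Uz
          π := { app := fun j => (hc j).some
                 naturality := fun _ _ _ => (subsingleton_hom _ _).elim _ _ } }
      have := sliceDiv_dvd_of_hom (hl.lift s)
      rw [hUz] at this
      exact this
  · rintro ⟨S, hS, hne, hdir, hbd, hlub⟩
    -- the index category: the elements of `S`, ordered by REVERSED divisibility, lifted to the right universe
    let J : Type (max v w) :=
      ULift.{v} {s : (DivOrder ((PreFrobenioidData.perfection hF).ops.monFunctor.obj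
      (op (PreFrobenioid.baseObj (PreFrobenioidData.perfection hF).ops.toFunctor X))))ᵒᵈ //
        OrderDual.ofDual s ∈ S}
    letI : SmallCategory J := Preorder.smallCategory J
    haveI : Nonempty J := by
      obtain ⟨s, hs⟩ := hne
      exact ⟨⟨⟨OrderDual.toDual s, hs⟩⟩⟩
    haveI : IsDirected J (· ≥ ·) := ⟨fun a b => by
      obtain ⟨c, hc, hac, hbc⟩ := hdir _ a.down.2 _ b.down.2
      exact ⟨⟨⟨OrderDual.toDual c, hc⟩⟩, hac, hbc⟩⟩
    haveI : IsCofiltered J := isCofiltered_of_directed_ge_nonempty J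
    -- the chosen O^▷-like objects
    have hobj : ∀ j : J, ∃ U : CoaPreOver (PreFrobenioidData.perfection hF) X,
        IsOTriLikePreStep (PreFrobenioidData.perfection hF) U.obj.hom ∧ sliceDiv hF U = OrderDual.ofDual j.down.1 :=
      fun j => hS _ j.down.2
    choose obj hobj₁ hobj₂ using hobj
    have hmap : ∀ {j j' : J}, (j ⟶ j') → Nonempty (obj j ⟶ obj j') := fun {j j'} f => by
      apply nonempty_hom_of_sliceDiv_dvd
      rw [hobj₂, hobj₂]
      exact leOfHom f
    let F : J ⥤ CoaPreOver (PreFrobenioidData.perfection hF) X :=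
      { obj := obj
        map := fun f => (hmap f).some
        map_id := fun _ => (subsingleton_hom _ _).elim _ _
        map_comp := fun _ _ => (subsingleton_hom _ _).elim _ _ }
    have hπ : ∀ j : J, Nonempty ((⟨Over.mk ψ, hψ⟩ : CoaPreOver (PreFrobenioidData.perfection hF) X) ⟶ F.obj j) :=
      fun j => nonempty_hom_of_sliceDiv_dvd (by
        rw [show sliceDiv hF (F.obj j) = _ from hobj₂ j]; exact hbd _ j.down.2)
    let π : (Functor.const J).obj (⟨Over.mk ψ, hψ⟩ : CoaPreOver (PreFrobenioidData.perfection hF) X) ⟶ F :=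
      { app := fun j => (hπ j).some
        naturality := fun _ _ _ => (subsingleton_hom _ _).elim _ _ }
    refine ⟨hψ, J, inferInstance, inferInstance, F, π, fun j => hobj₁ j, ⟨isLimitOfForall _ fun s => ?_⟩⟩
    apply nonempty_hom_of_sliceDiv_dvd
    apply hlub
    intro t ht
    have a : s.pt ⟶ F.obj ⟨⟨OrderDual.toDual t, ht⟩⟩ := s.π.app ⟨⟨OrderDual.toDual t, ht⟩⟩
    have := sliceDiv_dvd_of_hom a
    rwa [show sliceDiv hF (F.obj ⟨⟨OrderDual.toDual t, ht⟩⟩) = _ from hobj₂ _] at this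

end Cor38Criterion

end Literature.AnabelianGeometry.EtaleTheta
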